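import Mathlib
import HarnessLib
import Summits.CriticalPhenomena.Ising3DConformalLimit.Theses.PlantedPinning

/-!
# Strategist redirect r1 — the estimation-theoretic split of the pinning efficiency

Scratch file of the crux-strategist seat `cstrat-stmt-CriticalPhenomena-8451-r1`
(second opinion after the `-s` censuses s1–s4).  Nothing here is a route item; the file
certifies the *typed* statements quoted in `STRATEGY-CENSUS-r1.md`.

New object (not in s1–s4, not in the registered line `Lines/birth.lean`): the **linear
(Gaussian-surrogate) pinning curve** `pvarLin` — the average over pin sets `P` of the error of
the best AFFINE predictor of `M` from the pinned spins `σ_P` — and the **nonlinear gain**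
`gain = pvarLin - pvar ≥ 0` (MMSE ≤ LMMSE; `= ‖E[M|σ_P] - BLP_P M‖²`, zero for Gaussian laws).

* `eff_eq_effLin_sub_gammaEff` : `e_L(k) = e^lin_L(k) - Γ_L(k)` (definitional bookkeeping);
* `SchurPinningCeiling` : `e^lin ≤ 1` — the pinning lemma for the Gaussian vector with the Ising
  covariance (Schur-complement Riccati argument; provable now, support-sized);
* `NonlinearGainFloor` (Γ-floor) and the two sorry-free directions
  `deficit_of_gainFloor : SchurPinningCeiling → NonlinearGainFloor → PinningEfficiencyDeficit`,
  `gainFloor_of_deficit : SurrogateSaturation → PinningEfficiencyDeficit → NonlinearGainFloor`: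
  modulo two TWO-POINT statements the crux IS a scale-uniform floor on nonlinear response;
* `WitnessBound` : the test-function (dual) form of a Γ lower bound — every lower bound on the
  gain is a correlation `E[M·g(σ_P)]` of the UNPINNED critical state with an affine-orthogonal
  pin statistic `g`; for the Wick cubic `g` this is a `U₄`-sum at the screening scale `L*(p)`.
-/

namespace Summit.CriticalPhenomena.Ising3DConformalLimit.Cruxes.PinningEfficiencyDeficit.StratR1

open scoped BigOperators Classical
open Literature.Probability.LatticeModels
open Summit.CriticalPhenomena.Ising3DConformalLimit.Theses.PlantedPinning

noncomputable section

/-! ## The route's let-tower as closed terms (definitional, as in `Sketch_s4.lean`) -/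

/-- β_c(3). -/
def βc : ℝ := Literature.Probability.LatticeModels.criticalBeta 3

/-- total magnetisation of the box Λ_L. -/
def M : ℕ → SpinConfig (Site 3) → ℝ :=
  fun L σ => ∑ x ∈ box 3 L, spinAt x σ

/-- conditional variance of `M` given the pins `P` planted from `η` (route's `cvar`). -/
def cvar : ℕ → Finset (Site 3) → SpinConfig (Site 3) → ℝ :=
  fun L P η => isingExpect (zdGraph 3) (box 3 L \ P) βc 0 (.fixed η) (fun σ => M L σ ^ 2)
    - isingExpect (zdGraph 3) (box 3 L \ P) βc 0 (.fixed η) (M L) ^ 2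

/-- `MMSE(M | σ_P) = E_τ Var(M | σ_P = τ_P)`, in the route's planted form (inner sum of `pvar`). -/
def mmse (L : ℕ) (P : Finset (Site 3)) : ℝ :=
  ∑ τ : ↥(box 3 L) → ℤˣ,
    isingWeight (zdGraph 3) (box 3 L) βc 0 .plus τ / isingPartitionFunction (zdGraph 3) (box 3 L) βc 0 .plus
      * cvar L P (glue (box 3 L) τ .plus)

/-- planted conditional variance `v_{L,k}` (route's `pvar`). -/
def pvar : ℕ → ℕ → ℝ :=
  fun L k => (∑ P ∈ (box 3 L).powersetCard k, mmse L P) / ((box 3 L).card.choose k : ℝ)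

/-- pinning efficiency `e_L(k)` (route's `eff`). -/
def eff : ℕ → ℕ → ℝ :=
  fun L k => (k : ℝ) * pvar L k / ((((box 3 L).card : ℝ) + 1) * (((box 3 L).card : ℝ) - k + 1))

/-- The crux with the `let`-tower replaced by the closed terms above (definitional). -/
theorem deficit_iff :
    PinningEfficiencyDeficit ↔
      ∃ ε : ℝ, 0 < ε ∧ ∃ p₀ : ℝ, 0 < p₀ ∧ ∀ p : ℝ, 0 < p → p < p₀ → ∃ L₀ : ℕ, ∀ L ≥ L₀,
        eff L ⌈p * ((box 3 L).card : ℝ)⌉₊ ≤ 1 - ε :=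
  Iff.rfl

/-! ## The new object: the linear (Gaussian-surrogate) pinning curve and the nonlinear gain -/

/-- `μ⁺_{Λ_L;β_c,0}` expectation. -/
def μexp (L : ℕ) (f : SpinConfig (Site 3) → ℝ) : ℝ :=
  isingExpect (zdGraph 3) (box 3 L) βc 0 .plus f

/-- mean-square error of the AFFINE predictor `a + Σ_{y∈P} b_y σ_y` of `M`. -/
def affErr (L : ℕ) (P : Finset (Site 3)) (a : ℝ) (b : Site 3 → ℝ) : ℝ :=
  μexp L (fun σ => (M L σ - (a + ∑ y ∈ P, b y * spinAt y σ)) ^ 2)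

/-- `LMMSE(M | σ_P)`: the error of the best affine predictor of `M` from the pinned spins — the
conditional variance of `Σφ` given `φ_P` for the GAUSSIAN vector `φ` with the Ising mean and
covariance (a Schur complement of the finite-volume two-point matrix); value-blind. -/
def lmmse (L : ℕ) (P : Finset (Site 3)) : ℝ :=
  ⨅ c : ℝ × (Site 3 → ℝ), affErr L P c.1 c.2

/-- linear pinning curve `v^lin_{L,k}` = average of `LMMSE(M | σ_P)` over `|P| = k`. -/
def pvarLin (L k : ℕ) : ℝ :=
  (∑ P ∈ (box 3 L).powersetCard k, lmmse L P) / ((box 3 L).card.choose k : ℝ)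

/-- linear pinning efficiency `e^lin_L(k)`. -/
def effLin (L k : ℕ) : ℝ :=
  (k : ℝ) * pvarLin L k / ((((box 3 L).card : ℝ) + 1) * (((box 3 L).card : ℝ) - k + 1))

/-- nonlinear gain `LMMSE - MMSE`, averaged over `|P| = k`
(`= E_P ‖E[M | σ_P] - BLP_P M‖²_{L²(μ)}`; identically `0` for a Gaussian law). -/
def gain (L k : ℕ) : ℝ :=
  (∑ P ∈ (box 3 L).powersetCard k, (lmmse L P - mmse L P)) / ((box 3 L).card.choose k : ℝ)

/-- normalised nonlinear gain `Γ_L(k) = k·gain/((n+1)(n-k+1))`. -/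
def gammaEff (L k : ℕ) : ℝ :=
  (k : ℝ) * gain L k / ((((box 3 L).card : ℝ) + 1) * (((box 3 L).card : ℝ) - k + 1))

theorem pvar_eq_pvarLin_sub_gain (L k : ℕ) : pvar L k = pvarLin L k - gain L k := by
  unfold pvar pvarLin gain
  rw [Finset.sum_sub_distrib]
  ring

/-- **Bookkeeping identity**: `e = e^lin - Γ`. -/
theorem eff_eq_effLin_sub_gammaEff (L k : ℕ) : eff L k = effLin L k - gammaEff L k := by
  unfold eff effLin gammaEff
  rw [pvar_eq_pvarLin_sub_gain]
  ring

/-! ## Typed statements -/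

/-- SUPPORT (provable now: conditional expectation is the `L²`-optimal predictor, affine
predictors are a subclass; DLR identity for the planted form of `mmse`).  Gives `Γ ≥ 0`. -/
def MmseLeLmmse : Prop :=
  ∀ L : ℕ, ∀ P : Finset (Site 3), P ⊆ box 3 L → mmse L P ≤ lmmse L P

/-- SUPPORT (provable now, the *Schur-complement pinning lemma*): the pinning lemma for the
Gaussian vector with the Ising covariance — one-step drop is the exact rank-one Schur update
`v(P) - v(P ∪ z) = (row-sum)²/(C/C_PP)_{zz}` with `(C/C_PP)_{zz} ≤ C_{zz} ≤ 1`, then the Riccati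
argument of `PinningLemmaCeiling` verbatim.  Hence `e ≤ e^lin ≤ 1`: the two-point part of the
ceiling is saturated by linear estimation and carries NO p-uniform deficit of its own unless
`SurrogateSaturation` fails. -/
def SchurPinningCeiling : Prop :=
  ∀ L k : ℕ, effLin L k ≤ 1

/-- TWO-POINT CONJECTURE (believed TRUE; the linear analogue of the route's r3): the
Gaussian surrogate saturates the ceiling, `e^lin_L(⌈pn⌉) → 1` as `L → ∞` then `p → 0`
(value-blind conditioning: the three ceiling losses are laws of large numbers over the
`≍ p^{-0.53}` pins of a screening block). -/
def SurrogateSaturation : Prop :=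
  ∀ ε : ℝ, 0 < ε → ∃ p₀ : ℝ, 0 < p₀ ∧ ∀ p : ℝ, 0 < p → p < p₀ → ∃ L₀ : ℕ, ∀ L ≥ L₀,
    1 - ε ≤ effLin L ⌈p * ((box 3 L).card : ℝ)⌉₊

/-- Γ-FLOOR (the crux re-dressed: a scale-uniform floor on NONLINEAR response of the posterior
mean of `M` to a density-`p` planted sample). -/
def NonlinearGainFloor : Prop :=
  ∃ ε : ℝ, 0 < ε ∧ ∃ p₀ : ℝ, 0 < p₀ ∧ ∀ p : ℝ, 0 < p → p < p₀ → ∃ L₀ : ℕ, ∀ L ≥ L₀,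
    ε ≤ gammaEff L ⌈p * ((box 3 L).card : ℝ)⌉₊

/-- `g` depends only on the spins in `P`. -/
def DependsOnlyOn (P : Finset (Site 3)) (g : SpinConfig (Site 3) → ℝ) : Prop :=
  ∀ σ σ' : SpinConfig (Site 3), (∀ y ∈ P, σ y = σ' y) → g σ = g σ'

/-- SUPPORT (provable now, finite-dimensional `L²` geometry): the WITNESS / dual form of a
gain lower bound.  For any pin statistic `g(σ_P)` orthogonal to the affine functions of `σ_P`,
`E[g²]·(LMMSE - MMSE)(P) ≥ E[M g]²` — an UNCONDITIONAL correlation of the unpinned state. -/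
def WitnessBound : Prop :=
  ∀ L : ℕ, ∀ P : Finset (Site 3), P ⊆ box 3 L → ∀ g : SpinConfig (Site 3) → ℝ,
    DependsOnlyOn P g → μexp L g = 0 → (∀ y ∈ P, μexp L (fun σ => g σ * spinAt y σ) = 0) →
      μexp L (fun σ => M L σ * g σ) ^ 2 ≤ μexp L (fun σ => g σ ^ 2) * (lmmse L P - mmse L P)

/-! ## The two directions (sorry-free) -/

/-- Γ-floor ⇒ crux, through the Schur pinning ceiling only. -/
theorem deficit_of_gainFloor (hS : SchurPinningCeiling) (hG : NonlinearGainFloor) :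
    PinningEfficiencyDeficit := by
  rw [deficit_iff]
  obtain ⟨ε, hε, p₀, hp₀, h⟩ := hG
  refine ⟨ε, hε, p₀, hp₀, fun p hp hpp => ?_⟩
  obtain ⟨L₀, hL₀⟩ := h p hp hpp
  refine ⟨L₀, fun L hL => ?_⟩
  have h₁ := hL₀ L hL
  have h₂ := hS L ⌈p * ((box 3 L).card : ℝ)⌉₊
  rw [eff_eq_effLin_sub_gammaEff]
  linarith

/-- crux ⇒ Γ-floor, given saturation of the Gaussian surrogate: modulo two-point statements
the crux is EXACTLY a scale-uniform nonlinear-response floor. -/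
theorem gainFloor_of_deficit (hSat : SurrogateSaturation) (hD : PinningEfficiencyDeficit) :
    NonlinearGainFloor := by
  rw [deficit_iff] at hD
  obtain ⟨ε, hε, p₀, hp₀, h⟩ := hD
  obtain ⟨p₁, hp₁, h₁⟩ := hSat (ε / 2) (by linarith)
  refine ⟨ε / 2, by linarith, min p₀ p₁, lt_min hp₀ hp₁, fun p hp hpp => ?_⟩
  obtain ⟨L₀, hL₀⟩ := h p hp (lt_of_lt_of_le hpp (min_le_left _ _))
  obtain ⟨L₁, hL₁⟩ := h₁ p hp (lt_of_lt_of_le hpp (min_le_right _ _))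
  refine ⟨max L₀ L₁, fun L hL => ?_⟩
  have a := hL₀ L (le_trans (le_max_left _ _) hL)
  have b := hL₁ L (le_trans (le_max_right _ _) hL)
  rw [eff_eq_effLin_sub_gammaEff] at a
  linarith

/-- The best typed split this seat can offer (see census §Decomposition): two provable-now
supports and ONE open piece which is the crux re-dressed — not an honest `k ≥ 2` split. -/
theorem deficit_of_split :
    SchurPinningCeiling → MmseLeLmmse → NonlinearGainFloor → PinningEfficiencyDeficit :=
  fun hS _ hG => deficit_of_gainFloor hS hG

end

end Summit.CriticalPhenomena.Ising3DConformalLimit.Cruxes.PinningEfficiencyDeficit.StratR1
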